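import Summits.Ventures.LatticeQCDFlow.Scoring.AdConjugationCommutant
import Summits.Ventures.LatticeQCDFlow.Scoring.UNOnePlaquetteCumulants
import Mathlib.MeasureTheory.Group.Integral
import HarnessLib

/-!
# The one-plaquette two-point function of `U(N)` matrix elements: `∫ (U X U*)_{ab} e^{β Re tr U} dU = A(β)·X_{ab} + B(β)·tr(X)·δ_{ab}`, every `N ≥ 2`, every `β`

HONEST FRAMING: exact (Metropolis-corrected) sampling algorithms for lattice gauge theory;
figures of merit are autocorrelation/cost numbers at stated couplings and volumes; no
continuum-physics claim.

Venture `LatticeQCDFlow` (cell pub-lqcd), sub-topic `Scoring`; FANOUT row 5 (`s0-sun-a`), GEN-20.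
NEW WORK of the cell (placement rule).  Second input of the exact second moment of two-dimensional Wilson loops: under the
`U(N)` one-plaquette weight `e^{β Re tr U} dU`, the entrywise integral `X ↦ ∫ (U X U*) e^{β Re tr U} dU` is a linear map on
`M_N(ℂ)` commuting with every unitary conjugation (Haar measure is conjugation invariant, the weight is a class function), so
by `AdConjugationCommutant` it is `X ↦ A·X + B·tr(X)·1`; `X = 1` and the "trace" `Σ_{jk} (·)(E_{jk})_{jk}` fix the constants:

* §1 `integrable_conj_entry_mul_weight`, `integral_conj_entry_conj` (conjugation covariance of the entrywise integrals);
* §2 **`integral_unitary_conj_entry_mul_exp`** — with `D = det[I_{|i−j|}(β)] = ∫ e^{βRe tr U}` and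
  `M₂ = ∫ |tr U|² e^{β Re tr U}`: `∫ (U X U*)_{ab} e^{β Re tr U} dU = A·X_{ab} + B·tr(X)·δ_{ab}`,
  `A = (M₂ − D)/(N² − 1)`, `B = (D − A)/N` — i.e. `⟨U X U*⟩_β = P_adj(β)·X + ((1 − P_adj(β))/N)·tr(X)·1` with the adjoint
  plaquette `P_adj = (⟨|tr U|²⟩_β − 1)/(N² − 1)` of `AdjointPlaquetteWeakCoupling`.

No `def`, nothing cited as a fact, 0 sorry.
-/

noncomputable section

open Real MeasureTheory Filter Topology Finset Matrix
open Complex (I)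
open Literature.MathematicalPhysics.QuantumFieldTheory (haarProbability)
open Literature.Analysis.FunctionSpaces (besselI)

namespace Summit.Ventures.LatticeQCDFlow.Scoring

section TwoPoint

variable {N : ℕ}

/-! ### 1. The entrywise conjugation integrals -/

/-- `u ↦ (u X u*)_{ab} · e^{β Re tr u}` is integrable on `U(N)` (continuous on a compact group). -/
theorem integrable_conj_entry_mul_weight (β : ℝ) (X : Matrix (Fin N) (Fin N) ℂ) (a b : Fin N) :
    Integrable (fun u : Matrix.unitaryGroup (Fin N) ℂ => (((u : Matrix.unitaryGroup (Fin N) ℂ) : Matrix (Fin N) (Fin N) ℂ) * X * star ((u : Matrix.unitaryGroup (Fin N) ℂ) : Matrix (Fin N) (Fin N) ℂ)) a b * (Real.exp (β * ((u : Matrix.unitaryGroup (Fin N) ℂ) : Matrix (Fin N) (Fin N) ℂ).trace.re) : ℂ)) (haarProbability (Matrix.unitaryGroup (Fin N) ℂ)) := by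
  have hc : Continuous fun u : Matrix.unitaryGroup (Fin N) ℂ => (((u : Matrix.unitaryGroup (Fin N) ℂ) : Matrix (Fin N) (Fin N) ℂ) * X * star ((u : Matrix.unitaryGroup (Fin N) ℂ) : Matrix (Fin N) (Fin N) ℂ)) a b * (Real.exp (β * ((u : Matrix.unitaryGroup (Fin N) ℂ) : Matrix (Fin N) (Fin N) ℂ).trace.re) : ℂ) := by
    refine (Continuous.matrix_elem ((continuous_subtype_val.matrix_mul continuous_const).matrix_mul
      (continuous_subtype_val.star)) a b).mul ?_
    exact Complex.continuous_ofReal.comp (Real.continuous_exp.comp (continuous_const.mul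
      (Complex.continuous_re.comp (continuous_id.matrix_trace.comp continuous_subtype_val))))
  exact hc.integrable_of_hasCompactSupport (HasCompactSupport.of_compactSpace _)

/-- Conjugation invariance of the Haar probability: `∫ f(g u g⁻¹) du = ∫ f(u) du`. -/
theorem integral_conj_eq_self (f : Matrix.unitaryGroup (Fin N) ℂ → ℂ) (g : Matrix.unitaryGroup (Fin N) ℂ) :
    ∫ u, f (g * u * g⁻¹) ∂(haarProbability (Matrix.unitaryGroup (Fin N) ℂ)) = ∫ u, f u ∂(haarProbability (Matrix.unitaryGroup (Fin N) ℂ)) := by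
  have h1 := integral_mul_right_eq_self (μ := (haarProbability (Matrix.unitaryGroup (Fin N) ℂ))) (fun u => f (g * u)) g⁻¹
  have h2 := integral_mul_left_eq_self (μ := (haarProbability (Matrix.unitaryGroup (Fin N) ℂ))) f g
  calc ∫ u, f (g * u * g⁻¹) ∂(haarProbability (Matrix.unitaryGroup (Fin N) ℂ)) = ∫ u, f (g * (u * g⁻¹)) ∂(haarProbability (Matrix.unitaryGroup (Fin N) ℂ)) := by simp_rw [mul_assoc]
    _ = ∫ u, f (g * u) ∂(haarProbability (Matrix.unitaryGroup (Fin N) ℂ)) := h1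
    _ = ∫ u, f u ∂(haarProbability (Matrix.unitaryGroup (Fin N) ℂ)) := h2

/-- **Conjugation covariance**: `∫ (u (gXg*) u*)_{ab} e^{βRe tr u} du = Σ_{c,d} g_{ac} (∫ (uXu*)_{cd} e^{βRe tr u} du) (g*)_{db}`. -/
theorem integral_conj_entry_conj (β : ℝ) (X : Matrix (Fin N) (Fin N) ℂ) (g : Matrix.unitaryGroup (Fin N) ℂ) (a b : Fin N) :
    ∫ u, (((u : Matrix.unitaryGroup (Fin N) ℂ) : Matrix (Fin N) (Fin N) ℂ) * (((g : Matrix.unitaryGroup (Fin N) ℂ) : Matrix (Fin N) (Fin N) ℂ) * X * star ((g : Matrix.unitaryGroup (Fin N) ℂ) : Matrix (Fin N) (Fin N) ℂ)) *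
        star ((u : Matrix.unitaryGroup (Fin N) ℂ) : Matrix (Fin N) (Fin N) ℂ)) a b * (Real.exp (β * ((u : Matrix.unitaryGroup (Fin N) ℂ) : Matrix (Fin N) (Fin N) ℂ).trace.re) : ℂ) ∂(haarProbability (Matrix.unitaryGroup (Fin N) ℂ))
      = ∑ c, ∑ d, ((g : Matrix.unitaryGroup (Fin N) ℂ) : Matrix (Fin N) (Fin N) ℂ) a c *
          (∫ u, (((u : Matrix.unitaryGroup (Fin N) ℂ) : Matrix (Fin N) (Fin N) ℂ) * X * star ((u : Matrix.unitaryGroup (Fin N) ℂ) : Matrix (Fin N) (Fin N) ℂ)) c d * (Real.exp (β * ((u : Matrix.unitaryGroup (Fin N) ℂ) : Matrix (Fin N) (Fin N) ℂ).trace.re) : ℂ) ∂(haarProbability (Matrix.unitaryGroup (Fin N) ℂ))) *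
          (star ((g : Matrix.unitaryGroup (Fin N) ℂ) : Matrix (Fin N) (Fin N) ℂ)) d b := by
  -- substitute `u ↦ g u g⁻¹`
  rw [← integral_conj_eq_self (fun u : Matrix.unitaryGroup (Fin N) ℂ => (((u : Matrix.unitaryGroup (Fin N) ℂ) : Matrix (Fin N) (Fin N) ℂ) *
      (((g : Matrix.unitaryGroup (Fin N) ℂ) : Matrix (Fin N) (Fin N) ℂ) * X * star ((g : Matrix.unitaryGroup (Fin N) ℂ) : Matrix (Fin N) (Fin N) ℂ)) *
      star ((u : Matrix.unitaryGroup (Fin N) ℂ) : Matrix (Fin N) (Fin N) ℂ)) a b * (Real.exp (β * ((u : Matrix.unitaryGroup (Fin N) ℂ) : Matrix (Fin N) (Fin N) ℂ).trace.re) : ℂ)) g]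
  have hpt : ∀ u : Matrix.unitaryGroup (Fin N) ℂ,
      ((((g * u * g⁻¹ : Matrix.unitaryGroup (Fin N) ℂ)) : Matrix (Fin N) (Fin N) ℂ) *
        (((g : Matrix.unitaryGroup (Fin N) ℂ) : Matrix (Fin N) (Fin N) ℂ) * X * star ((g : Matrix.unitaryGroup (Fin N) ℂ) : Matrix (Fin N) (Fin N) ℂ)) *
        star (((g * u * g⁻¹ : Matrix.unitaryGroup (Fin N) ℂ)) : Matrix (Fin N) (Fin N) ℂ)) a b *
        (Real.exp (β * (((g * u * g⁻¹ : Matrix.unitaryGroup (Fin N) ℂ)) : Matrix (Fin N) (Fin N) ℂ).trace.re) : ℂ)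
      = ∑ c, ∑ d, ((g : Matrix.unitaryGroup (Fin N) ℂ) : Matrix (Fin N) (Fin N) ℂ) a c *
          ((((u : Matrix.unitaryGroup (Fin N) ℂ) : Matrix (Fin N) (Fin N) ℂ) * X * star ((u : Matrix.unitaryGroup (Fin N) ℂ) : Matrix (Fin N) (Fin N) ℂ)) c d * (Real.exp (β * ((u : Matrix.unitaryGroup (Fin N) ℂ) : Matrix (Fin N) (Fin N) ℂ).trace.re) : ℂ)) * (star ((g : Matrix.unitaryGroup (Fin N) ℂ) : Matrix (Fin N) (Fin N) ℂ)) d b := by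
    intro u
    rw [trace_conj_unitaryGroup]
    have hg : star ((g : Matrix.unitaryGroup (Fin N) ℂ) : Matrix (Fin N) (Fin N) ℂ) * ((g : Matrix.unitaryGroup (Fin N) ℂ) : Matrix (Fin N) (Fin N) ℂ) = 1 :=
      Matrix.UnitaryGroup.star_mul_self g
    have hmat : (((g * u * g⁻¹ : Matrix.unitaryGroup (Fin N) ℂ)) : Matrix (Fin N) (Fin N) ℂ) *
        (((g : Matrix.unitaryGroup (Fin N) ℂ) : Matrix (Fin N) (Fin N) ℂ) * X * star ((g : Matrix.unitaryGroup (Fin N) ℂ) : Matrix (Fin N) (Fin N) ℂ)) *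
        star (((g * u * g⁻¹ : Matrix.unitaryGroup (Fin N) ℂ)) : Matrix (Fin N) (Fin N) ℂ)
        = ((g : Matrix.unitaryGroup (Fin N) ℂ) : Matrix (Fin N) (Fin N) ℂ) * (((u : Matrix.unitaryGroup (Fin N) ℂ) : Matrix (Fin N) (Fin N) ℂ) * X * star ((u : Matrix.unitaryGroup (Fin N) ℂ) : Matrix (Fin N) (Fin N) ℂ)) *
          star ((g : Matrix.unitaryGroup (Fin N) ℂ) : Matrix (Fin N) (Fin N) ℂ) := by
      rw [show (((g * u * g⁻¹ : Matrix.unitaryGroup (Fin N) ℂ)) : Matrix (Fin N) (Fin N) ℂ)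
          = ((g : Matrix.unitaryGroup (Fin N) ℂ) : Matrix (Fin N) (Fin N) ℂ) * ((u : Matrix.unitaryGroup (Fin N) ℂ) : Matrix (Fin N) (Fin N) ℂ) * star ((g : Matrix.unitaryGroup (Fin N) ℂ) : Matrix (Fin N) (Fin N) ℂ) from rfl]
      rw [star_mul, star_mul, star_star]
      -- `(g u g*) (g X g*) (g u* g*)  = g u (g* g) X (g* g) u* g*`
      calc ((g : Matrix.unitaryGroup (Fin N) ℂ) : Matrix (Fin N) (Fin N) ℂ) * ((u : Matrix.unitaryGroup (Fin N) ℂ) : Matrix (Fin N) (Fin N) ℂ) * star ((g : Matrix.unitaryGroup (Fin N) ℂ) : Matrix (Fin N) (Fin N) ℂ) *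
            (((g : Matrix.unitaryGroup (Fin N) ℂ) : Matrix (Fin N) (Fin N) ℂ) * X * star ((g : Matrix.unitaryGroup (Fin N) ℂ) : Matrix (Fin N) (Fin N) ℂ)) *
            (((g : Matrix.unitaryGroup (Fin N) ℂ) : Matrix (Fin N) (Fin N) ℂ) * (star ((u : Matrix.unitaryGroup (Fin N) ℂ) : Matrix (Fin N) (Fin N) ℂ) * star ((g : Matrix.unitaryGroup (Fin N) ℂ) : Matrix (Fin N) (Fin N) ℂ)))
          = ((g : Matrix.unitaryGroup (Fin N) ℂ) : Matrix (Fin N) (Fin N) ℂ) * ((u : Matrix.unitaryGroup (Fin N) ℂ) : Matrix (Fin N) (Fin N) ℂ) *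
            (star ((g : Matrix.unitaryGroup (Fin N) ℂ) : Matrix (Fin N) (Fin N) ℂ) * ((g : Matrix.unitaryGroup (Fin N) ℂ) : Matrix (Fin N) (Fin N) ℂ)) * X *
            (star ((g : Matrix.unitaryGroup (Fin N) ℂ) : Matrix (Fin N) (Fin N) ℂ) * ((g : Matrix.unitaryGroup (Fin N) ℂ) : Matrix (Fin N) (Fin N) ℂ)) *
            (star ((u : Matrix.unitaryGroup (Fin N) ℂ) : Matrix (Fin N) (Fin N) ℂ) * star ((g : Matrix.unitaryGroup (Fin N) ℂ) : Matrix (Fin N) (Fin N) ℂ)) := by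
            simp only [Matrix.mul_assoc]
        _ = ((g : Matrix.unitaryGroup (Fin N) ℂ) : Matrix (Fin N) (Fin N) ℂ) * (((u : Matrix.unitaryGroup (Fin N) ℂ) : Matrix (Fin N) (Fin N) ℂ) * X * star ((u : Matrix.unitaryGroup (Fin N) ℂ) : Matrix (Fin N) (Fin N) ℂ)) *
            star ((g : Matrix.unitaryGroup (Fin N) ℂ) : Matrix (Fin N) (Fin N) ℂ) := by
            rw [hg]; simp only [Matrix.mul_one, Matrix.mul_assoc]
    rw [hmat]
    generalize ((u : Matrix.unitaryGroup (Fin N) ℂ) : Matrix (Fin N) (Fin N) ℂ) * X * star ((u : Matrix.unitaryGroup (Fin N) ℂ) : Matrix (Fin N) (Fin N) ℂ) = Mx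
    rw [Matrix.mul_apply, Finset.sum_mul]
    simp_rw [Matrix.mul_apply, Finset.sum_mul]
    rw [Finset.sum_comm]
    exact Finset.sum_congr rfl fun c _ => Finset.sum_congr rfl fun d _ => by ring
  simp_rw [hpt]
  rw [integral_finsetSum _ (fun c _ => ?_)]
  · refine Finset.sum_congr rfl fun c _ => ?_
    rw [integral_finsetSum _ (fun d _ => ?_)]
    · refine Finset.sum_congr rfl fun d _ => ?_
      rw [integral_mul_const, integral_const_mul]
    · exact ((integrable_conj_entry_mul_weight β X c d).const_mul _).mul_const _
  · exact integrable_finsetSum _ fun d _ => ((integrable_conj_entry_mul_weight β X c d).const_mul _).mul_const _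

/-! ### 2. The two-point function -/

/-- **THE ONE-PLAQUETTE TWO-POINT FUNCTION OF `U(N)` MATRIX ELEMENTS** (`N ≥ 2`, every real `β`, every `X ∈ M_N(ℂ)`):
`∫ (U X U*)_{ab} e^{β Re tr U} dU = A·X_{ab} + B·tr(X)·δ_{ab}` with `A = (M₂ − D)/(N² − 1)`, `B = (D − A)/N`,
`D = det[I_{|i−j|}(β)]`, `M₂ = ∫ |tr U|² e^{β Re tr U} dU`. -/
theorem integral_unitary_conj_entry_mul_exp (hN : 2 ≤ N) (β : ℝ) (X : Matrix (Fin N) (Fin N) ℂ) (a b : Fin N) :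
    ∫ u, (((u : Matrix.unitaryGroup (Fin N) ℂ) : Matrix (Fin N) (Fin N) ℂ) * X * star ((u : Matrix.unitaryGroup (Fin N) ℂ) : Matrix (Fin N) (Fin N) ℂ)) a b * (Real.exp (β * ((u : Matrix.unitaryGroup (Fin N) ℂ) : Matrix (Fin N) (Fin N) ℂ).trace.re) : ℂ) ∂(haarProbability (Matrix.unitaryGroup (Fin N) ℂ))
      = ((((∫ u, (‖((u : Matrix.unitaryGroup (Fin N) ℂ) : Matrix (Fin N) (Fin N) ℂ).trace‖ ^ 2 : ℝ) * Real.exp (β * ((u : Matrix.unitaryGroup (Fin N) ℂ) : Matrix (Fin N) (Fin N) ℂ).trace.re) ∂(haarProbability (Matrix.unitaryGroup (Fin N) ℂ))) - (Matrix.of fun i j : Fin N => besselI ((i : ℤ) - (j : ℤ)).natAbs β).det) / ((N : ℝ) ^ 2 - 1) : ℝ) : ℂ) * X a b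
        + ((((Matrix.of fun i j : Fin N => besselI ((i : ℤ) - (j : ℤ)).natAbs β).det - ((∫ u, (‖((u : Matrix.unitaryGroup (Fin N) ℂ) : Matrix (Fin N) (Fin N) ℂ).trace‖ ^ 2 : ℝ) * Real.exp (β * ((u : Matrix.unitaryGroup (Fin N) ℂ) : Matrix (Fin N) (Fin N) ℂ).trace.re) ∂(haarProbability (Matrix.unitaryGroup (Fin N) ℂ))) - (Matrix.of fun i j : Fin N => besselI ((i : ℤ) - (j : ℤ)).natAbs β).det) / ((N : ℝ) ^ 2 - 1)) / N : ℝ) : ℂ) *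
          (X.trace * (1 : Matrix (Fin N) (Fin N) ℂ) a b) := by
  set M₂ : ℝ := (∫ u, (‖((u : Matrix.unitaryGroup (Fin N) ℂ) : Matrix (Fin N) (Fin N) ℂ).trace‖ ^ 2 : ℝ) * Real.exp (β * ((u : Matrix.unitaryGroup (Fin N) ℂ) : Matrix (Fin N) (Fin N) ℂ).trace.re) ∂(haarProbability (Matrix.unitaryGroup (Fin N) ℂ))) with hM₂
  set D : ℝ := (Matrix.of fun i j : Fin N => besselI ((i : ℤ) - (j : ℤ)).natAbs β).det with hDdef
  -- the entrywise integral as a linear map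
  set T : Matrix (Fin N) (Fin N) ℂ →ₗ[ℂ] Matrix (Fin N) (Fin N) ℂ :=
    { toFun := fun X => Matrix.of fun a b => ∫ u, (((u : Matrix.unitaryGroup (Fin N) ℂ) : Matrix (Fin N) (Fin N) ℂ) * X * star ((u : Matrix.unitaryGroup (Fin N) ℂ) : Matrix (Fin N) (Fin N) ℂ)) a b * (Real.exp (β * ((u : Matrix.unitaryGroup (Fin N) ℂ) : Matrix (Fin N) (Fin N) ℂ).trace.re) : ℂ) ∂(haarProbability (Matrix.unitaryGroup (Fin N) ℂ))
      map_add' := by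
        intro X Y
        ext a b
        simp only [Matrix.of_apply, Matrix.add_apply]
        rw [← integral_add (integrable_conj_entry_mul_weight β X a b) (integrable_conj_entry_mul_weight β Y a b)]
        refine integral_congr_ae (Eventually.of_forall fun u => ?_)
        simp only [Matrix.mul_add, Matrix.add_mul, Matrix.add_apply]
        ring
      map_smul' := by
        intro c X
        ext a b
        simp only [Matrix.of_apply, Matrix.smul_apply, smul_eq_mul, RingHom.id_apply]
        rw [← integral_const_mul]
        refine integral_congr_ae (Eventually.of_forall fun u => ?_)
        simp only [Matrix.mul_smul, Matrix.smul_mul, Matrix.smul_apply, smul_eq_mul]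
        ring } with hT
  have hTapply : ∀ (Y : Matrix (Fin N) (Fin N) ℂ) (a b : Fin N), T Y a b = ∫ u, (((u : Matrix.unitaryGroup (Fin N) ℂ) : Matrix (Fin N) (Fin N) ℂ) * Y * star ((u : Matrix.unitaryGroup (Fin N) ℂ) : Matrix (Fin N) (Fin N) ℂ)) a b * (Real.exp (β * ((u : Matrix.unitaryGroup (Fin N) ℂ) : Matrix (Fin N) (Fin N) ℂ).trace.re) : ℂ) ∂(haarProbability (Matrix.unitaryGroup (Fin N) ℂ)) :=
    fun Y a b => rfl
  -- conjugation covariance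
  have hcov : ∀ (g : Matrix.unitaryGroup (Fin N) ℂ) (Y : Matrix (Fin N) (Fin N) ℂ),
      T (((g : Matrix.unitaryGroup (Fin N) ℂ) : Matrix (Fin N) (Fin N) ℂ) * Y * star ((g : Matrix.unitaryGroup (Fin N) ℂ) : Matrix (Fin N) (Fin N) ℂ))
        = ((g : Matrix.unitaryGroup (Fin N) ℂ) : Matrix (Fin N) (Fin N) ℂ) * T Y * star ((g : Matrix.unitaryGroup (Fin N) ℂ) : Matrix (Fin N) (Fin N) ℂ) := by
    intro g Y
    ext a b
    have hR : (((g : Matrix.unitaryGroup (Fin N) ℂ) : Matrix (Fin N) (Fin N) ℂ) * T Y * star ((g : Matrix.unitaryGroup (Fin N) ℂ) : Matrix (Fin N) (Fin N) ℂ)) a b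
        = ∑ c, ∑ d, ((g : Matrix.unitaryGroup (Fin N) ℂ) : Matrix (Fin N) (Fin N) ℂ) a c * T Y c d *
            (star ((g : Matrix.unitaryGroup (Fin N) ℂ) : Matrix (Fin N) (Fin N) ℂ)) d b := by
      generalize T Y = TY
      rw [Matrix.mul_apply]
      simp_rw [Matrix.mul_apply, Finset.sum_mul]
      rw [Finset.sum_comm]
    rw [hR, hTapply, integral_conj_entry_conj]
    simp only [hTapply]
  obtain ⟨A, B, hAB⟩ := linearMap_eq_of_commute_unitary_conj T hN hcov
  -- the two constants: `X = 1` gives `A + N B = D`; the trace gives `N² A + N B = M₂`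
  have hN0 : (N : ℂ) ≠ 0 := by exact_mod_cast (show N ≠ 0 by omega)
  have hN1 : ((N : ℂ) ^ 2 - 1) ≠ 0 := by
    have h2 : (2 : ℝ) ≤ N := by exact_mod_cast hN
    have : ((N : ℝ) ^ 2 - 1) ≠ 0 := by nlinarith
    exact_mod_cast this
  have hD : ∫ u, (Real.exp (β * ((u : Matrix.unitaryGroup (Fin N) ℂ) : Matrix (Fin N) (Fin N) ℂ).trace.re) : ℂ) ∂(haarProbability (Matrix.unitaryGroup (Fin N) ℂ)) = (D : ℂ) := by
    rw [hDdef, integral_complex_ofReal, integral_haar_unitaryGroup_fin_exp_mul_trace_re]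
  -- equation 1
  have h1 : A + N * B = (D : ℂ) := by
    have h := congrFun (congrFun (hAB 1) ⟨0, by omega⟩) ⟨0, by omega⟩
    rw [hTapply, Matrix.add_apply, Matrix.smul_apply, Matrix.smul_apply, Matrix.smul_apply, Matrix.trace_one,
      Fintype.card_fin, Matrix.one_apply_eq, smul_eq_mul, smul_eq_mul, smul_eq_mul, mul_one, mul_one] at h
    have e : ∀ u : Matrix.unitaryGroup (Fin N) ℂ, ((((u : Matrix.unitaryGroup (Fin N) ℂ) : Matrix (Fin N) (Fin N) ℂ) * 1 * star ((u : Matrix.unitaryGroup (Fin N) ℂ) : Matrix (Fin N) (Fin N) ℂ) : Matrix (Fin N) (Fin N) ℂ) ⟨0, by omega⟩ ⟨0, by omega⟩) * (Real.exp (β * ((u : Matrix.unitaryGroup (Fin N) ℂ) : Matrix (Fin N) (Fin N) ℂ).trace.re) : ℂ) = (Real.exp (β * ((u : Matrix.unitaryGroup (Fin N) ℂ) : Matrix (Fin N) (Fin N) ℂ).trace.re) : ℂ) := by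
      intro u
      rw [Matrix.mul_one, show ((u : Matrix.unitaryGroup (Fin N) ℂ) : Matrix (Fin N) (Fin N) ℂ) * star ((u : Matrix.unitaryGroup (Fin N) ℂ) : Matrix (Fin N) (Fin N) ℂ) = 1 from Matrix.mem_unitaryGroup_iff.mp u.2, Matrix.one_apply_eq, one_mul]
    simp_rw [e] at h
    rw [hD] at h
    rw [h]
    ring
  -- equation 2
  have h2 : (N : ℂ) ^ 2 * A + N * B = (M₂ : ℂ) := by
    have hsum : ∑ j : Fin N, ∑ k : Fin N, T (Matrix.single j k 1) j k = (M₂ : ℂ) := by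
      rw [hM₂, ← integral_complex_ofReal]
      simp_rw [hTapply]
      have hint : ∀ j k : Fin N, Integrable (fun u : Matrix.unitaryGroup (Fin N) ℂ =>
          ((((u : Matrix.unitaryGroup (Fin N) ℂ) : Matrix (Fin N) (Fin N) ℂ) * Matrix.single j k 1 * star ((u : Matrix.unitaryGroup (Fin N) ℂ) : Matrix (Fin N) (Fin N) ℂ) : Matrix (Fin N) (Fin N) ℂ) j k) * (Real.exp (β * ((u : Matrix.unitaryGroup (Fin N) ℂ) : Matrix (Fin N) (Fin N) ℂ).trace.re) : ℂ)) (haarProbability (Matrix.unitaryGroup (Fin N) ℂ)) :=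
        fun j k => integrable_conj_entry_mul_weight β _ j k
      have hinner : ∀ j : Fin N, ∑ k : Fin N, ∫ u, ((((u : Matrix.unitaryGroup (Fin N) ℂ) : Matrix (Fin N) (Fin N) ℂ) * Matrix.single j k 1 * star ((u : Matrix.unitaryGroup (Fin N) ℂ) : Matrix (Fin N) (Fin N) ℂ) : Matrix (Fin N) (Fin N) ℂ) j k) * (Real.exp (β * ((u : Matrix.unitaryGroup (Fin N) ℂ) : Matrix (Fin N) (Fin N) ℂ).trace.re) : ℂ) ∂(haarProbability (Matrix.unitaryGroup (Fin N) ℂ))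
          = ∫ u, ∑ k : Fin N, ((((u : Matrix.unitaryGroup (Fin N) ℂ) : Matrix (Fin N) (Fin N) ℂ) * Matrix.single j k 1 * star ((u : Matrix.unitaryGroup (Fin N) ℂ) : Matrix (Fin N) (Fin N) ℂ) : Matrix (Fin N) (Fin N) ℂ) j k) * (Real.exp (β * ((u : Matrix.unitaryGroup (Fin N) ℂ) : Matrix (Fin N) (Fin N) ℂ).trace.re) : ℂ) ∂(haarProbability (Matrix.unitaryGroup (Fin N) ℂ)) :=
        fun j => (integral_finsetSum _ (fun k _ => hint j k)).symm
      simp_rw [hinner]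
      rw [← integral_finsetSum _ (fun j _ => integrable_finsetSum _ (fun k _ => hint j k))]
      refine integral_congr_ae (Eventually.of_forall fun u => ?_)
      have hent : ∀ j k : Fin N, ((((u : Matrix.unitaryGroup (Fin N) ℂ) : Matrix (Fin N) (Fin N) ℂ) * Matrix.single j k 1 * star ((u : Matrix.unitaryGroup (Fin N) ℂ) : Matrix (Fin N) (Fin N) ℂ) : Matrix (Fin N) (Fin N) ℂ) j k)
          = ((u : Matrix.unitaryGroup (Fin N) ℂ) : Matrix (Fin N) (Fin N) ℂ) j j * star (((u : Matrix.unitaryGroup (Fin N) ℂ) : Matrix (Fin N) (Fin N) ℂ) k k) := by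
        intro j k
        rw [Matrix.mul_apply, Finset.sum_eq_single_of_mem k (Finset.mem_univ k) (fun d _ hd => by
          rw [Matrix.mul_single_apply_of_ne (i := j) (j := k) (a := j) (b := d) (hbj := hd), zero_mul]),
          Matrix.mul_single_apply_same (i := j) (j := k) (a := j), mul_one, Matrix.star_apply]
      simp_rw [hent, ← Finset.sum_mul]
      have htr : ∑ j : Fin N, ∑ k : Fin N, ((u : Matrix.unitaryGroup (Fin N) ℂ) : Matrix (Fin N) (Fin N) ℂ) j j * star (((u : Matrix.unitaryGroup (Fin N) ℂ) : Matrix (Fin N) (Fin N) ℂ) k k)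
          = (((‖((u : Matrix.unitaryGroup (Fin N) ℂ) : Matrix (Fin N) (Fin N) ℂ).trace‖ ^ 2 : ℝ)) : ℂ) := by
        rw [← Complex.normSq_eq_norm_sq, ← Complex.mul_conj, Matrix.trace, map_sum, Finset.sum_mul_sum]
        rfl
      rw [htr]
      push_cast
      ring
    have hsum2 : ∑ j : Fin N, ∑ k : Fin N, T (Matrix.single j k 1) j k = (N : ℂ) ^ 2 * A + N * B := by
      have hterm : ∀ j k : Fin N, T (Matrix.single j k 1) j k = A + (if j = k then B else 0) := by
        intro j k
        rw [hAB, Matrix.add_apply, Matrix.smul_apply, Matrix.single_apply_same, smul_eq_mul, mul_one, Matrix.smul_apply,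
          Matrix.smul_apply, smul_eq_mul, smul_eq_mul]
        by_cases h : j = k
        · subst h; rw [Matrix.trace_single_eq_same, Matrix.one_apply_eq, if_pos rfl]; ring
        · rw [Matrix.trace_single_eq_of_ne (h := h), if_neg h]; ring
      simp_rw [hterm]
      simp only [Finset.sum_add_distrib, Finset.sum_const, Finset.card_univ, Fintype.card_fin, Finset.sum_ite_eq,
        Finset.mem_univ, if_true, nsmul_eq_mul]
      ring
    rw [← hsum2, hsum]
  -- solve for `A`, `B` and conclude
  have hA : A = ((((M₂ - D) / ((N : ℝ) ^ 2 - 1) : ℝ)) : ℂ) := by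
    push_cast
    field_simp
    linear_combination h2 - h1
  have hB : B = (((D - (M₂ - D) / ((N : ℝ) ^ 2 - 1)) / N : ℝ) : ℂ) := by
    have hB' : B = ((D : ℂ) - A) / N := by
      field_simp
      linear_combination h1
    rw [hB', hA]
    push_cast
    ring
  have h := congrFun (congrFun (hAB X) a) b
  rw [hTapply, Matrix.add_apply, Matrix.smul_apply, Matrix.smul_apply, smul_eq_mul, smul_eq_mul, Matrix.smul_apply,
    smul_eq_mul, hA, hB] at h
  rw [h]

/-! ### 3. Haar measure: `∫ (U X U*) dU = tr(X)/N · 1` -/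

/-- **`∫_{U(N)} (U X U*)_{ab} dU = (tr X / N)·δ_{ab}`** (`N ≥ 2`): the case `β = 0` (`D = M₂ = 1`, so `A = 0`, `B = 1/N`). -/
theorem integral_unitary_conj_entry (hN : 2 ≤ N) (X : Matrix (Fin N) (Fin N) ℂ) (a b : Fin N) :
    ∫ u, (((u : Matrix.unitaryGroup (Fin N) ℂ) : Matrix (Fin N) (Fin N) ℂ) * X * star ((u : Matrix.unitaryGroup (Fin N) ℂ) : Matrix (Fin N) (Fin N) ℂ)) a b ∂(haarProbability (Matrix.unitaryGroup (Fin N) ℂ)) = X.trace / N * (1 : Matrix (Fin N) (Fin N) ℂ) a b := by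
  have h := integral_unitary_conj_entry_mul_exp hN 0 X a b
  have hM2 : (∫ u, (‖((u : Matrix.unitaryGroup (Fin N) ℂ) : Matrix (Fin N) (Fin N) ℂ).trace‖ ^ 2 : ℝ) * Real.exp (0 * ((u : Matrix.unitaryGroup (Fin N) ℂ) : Matrix (Fin N) (Fin N) ℂ).trace.re) ∂(haarProbability (Matrix.unitaryGroup (Fin N) ℂ))) = 1 := by
    simp_rw [zero_mul, Real.exp_zero, mul_one, ← Complex.normSq_eq_norm_sq]
    exact Summit.Ventures.LatticeQCDFlow.TrivializingMaps.un_integral_normSq_trace (by omega)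
  have hD : (Matrix.of fun i j : Fin N => besselI ((i : ℤ) - (j : ℤ)).natAbs 0).det = 1 := det_besselI_toeplitz_zero N
  simp_rw [zero_mul, Real.exp_zero, Complex.ofReal_one, mul_one] at h
  rw [h]
  simp_rw [zero_mul, Real.exp_zero, mul_one] at hM2
  rw [hD]
  have hM2' : (∫ u, (‖((u : Matrix.unitaryGroup (Fin N) ℂ) : Matrix (Fin N) (Fin N) ℂ).trace‖ ^ 2 : ℝ) ∂(haarProbability (Matrix.unitaryGroup (Fin N) ℂ))) = 1 := hM2
  rw [hM2']
  have hN0 : (N : ℂ) ≠ 0 := by exact_mod_cast (show N ≠ 0 by omega)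
  push_cast
  field_simp
  ring

end TwoPoint

end Summit.Ventures.LatticeQCDFlow.Scoring
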